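import Literature.MathematicalPhysics.QuantumLattice.HubbardPeriodicEquilibriumStatesNoMagneticOrder
import Literature.MathematicalPhysics.QuantumLattice.PeriodicVariationalPressureCouplings
import Literature.MathematicalPhysics.QuantumLattice.HubbardTTPrimeSourcedMeanEnergyMinimisers
import HarnessLib

/-!
# No SPONTANEOUS symmetry breaking in the two-dimensional `t–t'` Hubbard model at any `T > 0`, in Griffiths' thermodynamic form:
# the pressure has no kink in the staggered field (Ghosh 1971) nor in the singlet pair source (Koma–Tasaki 1992) at zero field,
# and the conjugate order parameters of equilibrium states in a vanishing field tend to zero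

Topic `Literature/MathematicalPhysics/QuantumLattice` (family `hubbard`; sequel of `HubbardPeriodicEquilibriumStatesNoMagneticOrder` and
`MerminWagnerPeriodicEquilibriumStates`, using the convexity / closed-graph apparatus of `PeriodicVariationalPressureCouplings`; the `T > 0`
companion of the cell's ground-state `h`-axis dictionary `DWaveOrderParameterInfiniteVolume`, where `m* = −∂⁺E(0)/2` may be positive).

**Ghosh, Phys. Rev. Lett. 27 (1971) 1584** (magnetisation) and **Koma–Tasaki, Phys. Rev. Lett. 68 (1992) 3248** (electron-pair
condensation) prove by Bogoliubov's inequality that in the one- and two-dimensional Hubbard models at every `T > 0` the order parameter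
induced by a symmetry-breaking field tends to `0` with the field: no SPONTANEOUS order. In the language of tangent functionals
(Griffiths 1964/1966; Israel 1979, Thm. I.2.4 and §I.3) this is the differentiability of the pressure in the field at zero field. This file
PROVES both forms, for every period vector `q` (periodic equilibrium states `InfVolFermionState.IsPerVarEquilibrium`):

* §1 (model-independent, any `d ≥ 1`, any linear family `Ψ(θ) = Ψ₀ + Σ_a θ_a Ψ_a`)
  **`FermionInteraction.tendsto_cellMeanEnergy_of_isPerVarEquilibrium_linearFamily`**: if the conjugate cell density `ē_q(Ψ_a)` takes ONE
  value `m₀` on all `q`-periodic equilibrium states at `(β, θ)`, then along ANY sequence of equilibrium states at couplings `θ_j → θ`,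
  `ē_q(Ψ_a)(ω_j) → m₀` (weak-⋆ compactness + closed graph + weak-⋆ continuity); and, for `β > 0`,
  **`FermionInteraction.hasDerivAt_perVarPressure_linearFamily_of_eq_const`**: `s ↦ P_q(β, Ψ(θ + s·1_a))` is differentiable at `s = 0`
  with derivative `−β m₀` (unique tangent ⇒ differentiable: the tangent plane of an equilibrium state at `θ` on one side, the Griffiths
  window at `θ + s1_a` on the other);
* §2 STAGGERED FIELD (`hubbardStaggered 2 t U (θ₀, θ₁)` of `PeriodicSublatticeAndStaggeredTerms`, zero Zeeman field): every periodic
  equilibrium state at `θ₁ = 0` has zero staggered-moment density for every averaging cell (`…cellMeanEnergy_staggeredSpinInteraction_eq_zero`),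
  hence **`hubbardStaggered_two_hasDerivAt_perVarPressure_zero_field`** (`h ↦ P_q(β, hubbardStaggered 2 t U (θ₀, h))` has derivative `0`
  at `0`, `β > 0`) and **`tendsto_staggeredMagnetisation_of_isPerVarEquilibrium_hubbardStaggered`** (`θ₁^{(j)} → 0` ⇒ `m_s(ω_j) → 0`, `β ≥ 0`);
* §3–§6 PAIR SOURCE (`hubbardTTPrimeSourcedInteraction t t' U μ g h = (Φ^{t,t',U} − μn) − hP_g` of `TIGroundEnergyDensityResponse`, singlet
  on-site / nearest-neighbour source with any real form factor `g`, e.g. `dWaveFormFactor`): every periodic equilibrium state of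
  `gcInteractionTT' t t' U μ h_z` has `ω(b_{x,y}) = 0` for every singlet pair, zero expectation of every source term and zero pair-source
  density (`…expect_singletPairAt_eq_zero_ttPrime`, `…expect_pairSourceInteraction_eq_zero_ttPrime`,
  `…cellMeanEnergy_pairSourceInteraction_eq_zero_ttPrime`); hence **`hubbardTTPrimeSourced_hasDerivAt_perVarPressure_zero_source`**,
  **`…hasDerivAt_varPressure_zero_source`**, **`…hasDerivAt_freePressure_zero_source`** (the periodic, the translation-invariant variational
  and the free-boundary THERMODYNAMIC pressure are differentiable in `h` at `0` with derivative `0`, every `β > 0`) and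
  **`tendsto_cellMeanEnergy_pairSource_of_isPerVarEquilibrium_sourced`** (`h_j → 0` ⇒ pair-source density `→ 0`, `β ≥ 0`).

Everything is PROVED (standard axioms); no definition, no named fact. `d = 3` and `T = 0` are untouched.

## References

* D. K. Ghosh, Phys. Rev. Lett. 27 (1971) 1584–1587. [cite: Ghosh1971]
* T. Koma, H. Tasaki, Phys. Rev. Lett. 68 (1992) 3248–3251. [cite: KomaTasakiPRL1992, p. 3]
* R. B. Griffiths, J. Math. Phys. 5 (1964) 1215, eq. (39); Phys. Rev. 152 (1966) 240, §II. [cite: Griffiths1964, Eq. (39) and Fig. 3] [cite: Griffiths1966, §II]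
* R. B. Israel, *Convexity in the Theory of Lattice Gases* (1979), Thm. I.2.4, §I.3. [cite: Israel1979, Thm. I.2.4]
* A. Klein, L. J. Landau, D. S. Shucker, J. Stat. Phys. 26 (1981) 505. [cite: KleinLandauShucker1981]
* T. Koma, H. Tasaki, J. Stat. Phys. 76 (1994) 745, §1 (sourced Hamiltonians). [cite: KomaTasaki1994, §1]
-/

noncomputable section

open scoped ComplexOrder BigOperators Matrix.Norms.L2Operator
open Finset Literature.InformationTheory.Entropy

namespace Literature.MathematicalPhysics.QuantumLattice

open Matrix Literature.Probability.LatticeModels ThermodynamicLimit HubbardWave0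
open _root_.Filter
open scoped _root_.Topology

variable {d : ℕ}

/-! ### §1 Unique conjugate density on the equilibrium states ⇒ differentiable pressure -/

section UniqueTangent

variable {ι : Type*} [Fintype ι] (Ψ₀ : FermionInteraction d) (Ψv : ι → FermionInteraction d) {β : ℝ}
  (q : Fin d → ℕ) (R : ℝ)

/-- **Along equilibrium states at converging couplings the conjugate density converges to its unique equilibrium value**: if
`ē_q(Ψ_a)(ω) = m₀` for every `q`-periodic equilibrium state `ω` at `(β, θ)`, then for every sequence `θ_j → θ` and equilibrium states
`ω_j` at `(β, θ_j)`: `ē_q(Ψ_a)(ω_j) → m₀` (weak-⋆ compactness, closed graph of the equilibrium correspondence, weak-⋆ continuity of `ē_q`).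
[cite: Israel1979, Thm. I.2.4] [cite: Griffiths1964, Eq. (39) and Fig. 3] -/
theorem FermionInteraction.tendsto_cellMeanEnergy_of_isPerVarEquilibrium_linearFamily (hd : 0 < d) {θ : ι → ℝ} (a : ι) {m₀ : ℝ}
    (hconst : ∀ ω : InfVolFermionState d, ω.IsPerVarEquilibrium β q (FermionInteraction.linearFamily Ψ₀ Ψv θ) R →
      InfVolFermionState.cellMeanEnergy q (Ψv a) ω R = m₀)
    {θs : ℕ → ι → ℝ} (hθ : ∀ b, Tendsto (fun j => θs j b) atTop (𝓝 (θ b))) {ωs : ℕ → InfVolFermionState d}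
    (hωs : ∀ j, (ωs j).IsPerVarEquilibrium β q (FermionInteraction.linearFamily Ψ₀ Ψv (θs j)) R) :
    Tendsto (fun j => InfVolFermionState.cellMeanEnergy q (Ψv a) (ωs j) R) atTop (𝓝 m₀) := by
  refine tendsto_of_subseq_tendsto fun ns hns => ?_
  obtain ⟨φ, hφ, ωl, hlim⟩ := InfVolFermionState.exists_tendsto_expect_subseq (fun j => ωs (ns j))
  refine ⟨φ, ?_⟩
  have hθ' : ∀ b, Tendsto (fun j => θs (ns (φ j)) b) atTop (𝓝 (θ b)) := fun b =>
    (hθ b).comp (hns.comp hφ.tendsto_atTop)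
  have hωl : ωl.IsPerVarEquilibrium β q (FermionInteraction.linearFamily Ψ₀ Ψv θ) R :=
    InfVolFermionState.isPerVarEquilibrium_of_tendsto_params hd hlim (fun j => hωs (ns (φ j))) tendsto_const_nhds hθ'
  rw [← hconst ωl hωl]
  exact InfVolFermionState.tendsto_cellMeanEnergy_of_tendsto_expect hlim q (Ψv a) R

/-- **UNIQUE TANGENT ⇒ DIFFERENTIABLE PRESSURE** (Griffiths / Israel): let `β > 0` and suppose the conjugate cell density `ē_q(Ψ_a)` takes
the single value `m₀` on all `q`-periodic equilibrium states of `Ψ(θ) = Ψ₀ + Σ θ_b Ψ_b` at `(β, θ)`. Then the periodic pressure along the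
`a`-th coupling, `s ↦ P_q(β, Ψ(θ + s·1_a))`, is differentiable at `s = 0` with derivative `−β m₀`: for `s > 0` (resp. `< 0`) the difference
quotient lies between `−βm₀` (tangent plane of an equilibrium state at `θ`) and `−β ē_q(Ψ_a)(ω_s)` for any equilibrium state `ω_s` at
`θ + s1_a` (Griffiths window), and `ē_q(Ψ_a)(ω_s) → m₀`. [cite: Israel1979, Thm. I.2.4] [cite: Griffiths1964, Eq. (39) and Fig. 3] -/
theorem FermionInteraction.hasDerivAt_perVarPressure_linearFamily_of_eq_const [DecidableEq ι] (hd : 0 < d) (hβ : 0 < β)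
    (θ : ι → ℝ) (a : ι) {m₀ : ℝ}
    (hconst : ∀ ω : InfVolFermionState d, ω.IsPerVarEquilibrium β q (FermionInteraction.linearFamily Ψ₀ Ψv θ) R →
      InfVolFermionState.cellMeanEnergy q (Ψv a) ω R = m₀) :
    HasDerivAt (fun s : ℝ => (FermionInteraction.linearFamily Ψ₀ Ψv (θ + Pi.single a s)).perVarPressure β q R) (-(β * m₀)) 0 := by
  classical
  set P : ℝ → ℝ := fun s => (FermionInteraction.linearFamily Ψ₀ Ψv (θ + Pi.single a s)).perVarPressure β q R with hP
  rw [hasDerivAt_iff_tendsto_slope]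
  have hP0 : P 0 = (FermionInteraction.linearFamily Ψ₀ Ψv θ).perVarPressure β q R := by
    simp only [hP, Pi.single_zero, add_zero]
  obtain ⟨ω₀, hω₀⟩ := FermionInteraction.exists_isPerVarEquilibrium hd β q (FermionInteraction.linearFamily Ψ₀ Ψv θ) R
  have hm₀ := hconst ω₀ hω₀
  -- two-sided bounds on the difference quotient at `s ≠ 0` through an equilibrium state at `θ + s·1_a`
  have hbounds : ∀ {s : ℝ}, s ≠ 0 → ∀ {ω : InfVolFermionState d},
      ω.IsPerVarEquilibrium β q (FermionInteraction.linearFamily Ψ₀ Ψv (θ + Pi.single a s)) R →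
      min (-(β * m₀)) (-(β * InfVolFermionState.cellMeanEnergy q (Ψv a) ω R)) ≤ slope P 0 s ∧
        slope P 0 s ≤ max (-(β * m₀)) (-(β * InfVolFermionState.cellMeanEnergy q (Ψv a) ω R)) := by
    intro s hs ω hω
    rw [slope_def_field, sub_zero, hP0]
    have hsub := hω₀.perVarPressure_sub_mul_le_update a s
    rw [hm₀] at hsub
    have hcancel : θ + Pi.single a s + Pi.single a (-s) = θ := by
      rw [add_assoc, ← Pi.single_add, add_neg_cancel, Pi.single_zero, add_zero]
    set e := InfVolFermionState.cellMeanEnergy q (Ψv a) ω R with he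
    set Ps := (FermionInteraction.linearFamily Ψ₀ Ψv (θ + Pi.single a s)).perVarPressure β q R with hPs
    set Pθ := (FermionInteraction.linearFamily Ψ₀ Ψv θ).perVarPressure β q R with hPθ
    have hPs' : P s = Ps := rfl
    rw [hPs']
    rcases lt_or_gt_of_ne hs with hneg | hpos
    · have hw := (hω.cellMeanEnergy_mem_Icc hβ a (neg_pos.2 hneg)).1
      rw [hcancel] at hw
      rw [div_le_iff₀ (mul_pos hβ (neg_pos.2 hneg))] at hw
      constructor
      · refine (min_le_right _ _).trans ?_
        rw [le_div_iff_of_neg hneg]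
        nlinarith
      · refine le_trans ?_ (le_max_left _ _)
        rw [div_le_iff_of_neg hneg]
        nlinarith
    · have hw := (hω.cellMeanEnergy_mem_Icc hβ a hpos).2
      rw [hcancel] at hw
      rw [le_div_iff₀ (mul_pos hβ hpos)] at hw
      constructor
      · refine (min_le_left _ _).trans ?_
        rw [le_div_iff₀ hpos]
        nlinarith
      · refine le_trans ?_ (le_max_right _ _)
        rw [div_le_iff₀ hpos]
        nlinarith
  -- subsequence principle along any sequence `s_j → 0`, `s_j ≠ 0`
  refine tendsto_of_subseq_tendsto fun ns hns => ?_
  rw [tendsto_nhdsWithin_iff] at hns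
  obtain ⟨hns0, hne⟩ := hns
  choose ωs hωs using fun j =>
    FermionInteraction.exists_isPerVarEquilibrium hd β q (FermionInteraction.linearFamily Ψ₀ Ψv (θ + Pi.single a (ns j))) R
  have hθ : ∀ b, Tendsto (fun j => (θ + Pi.single a (ns j) : ι → ℝ) b) atTop (𝓝 (θ b)) := by
    intro b
    by_cases hb : b = a
    · subst hb
      simp only [Pi.add_apply, Pi.single_eq_same]
      have h := hns0.const_add (θ b)
      rwa [add_zero] at h
    · simp only [Pi.add_apply, Pi.single_eq_of_ne hb, add_zero]
      exact tendsto_const_nhds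
  have hml := FermionInteraction.tendsto_cellMeanEnergy_of_isPerVarEquilibrium_linearFamily Ψ₀ Ψv q R hd a hconst hθ hωs
  refine ⟨id, ?_⟩
  have hlo : Tendsto (fun j => min (-(β * m₀)) (-(β * InfVolFermionState.cellMeanEnergy q (Ψv a) (ωs j) R))) atTop
      (𝓝 (-(β * m₀))) := by
    have h := (tendsto_const_nhds (x := -(β * m₀))).min ((hml.const_mul β).neg)
    rwa [min_self] at h
  have hhi : Tendsto (fun j => max (-(β * m₀)) (-(β * InfVolFermionState.cellMeanEnergy q (Ψv a) (ωs j) R))) atTop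
      (𝓝 (-(β * m₀))) := by
    have h := (tendsto_const_nhds (x := -(β * m₀))).max ((hml.const_mul β).neg)
    rwa [max_self] at h
  refine tendsto_of_tendsto_of_tendsto_of_le_of_le' hlo hhi (hne.mono fun j hj => (hbounds hj (hωs j)).1)
    (hne.mono fun j hj => (hbounds hj (hωs j)).2)

end UniqueTangent

/-! ### §2 The two-dimensional Hubbard model: no spontaneous staggered magnetisation at `T > 0` -/

/-- The staggered-field direction of `hubbardStaggered`: `(θ₀, 0) + s·1₁ = (θ₀, s)`. [cite: KomaTasaki1994, §1] -/
private theorem vec2_add_single_one (θ₀ s : ℝ) : (![θ₀, 0] : Fin 2 → ℝ) + Pi.single 1 s = ![θ₀, s] := by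
  funext i
  fin_cases i
  · simp
  · simp

section Hubbard

variable (t U : ℝ) {β : ℝ} {q : Fin 2 → ℕ} {ω : InfVolFermionState 2}

/-- **The cell density conjugate to the staggered field vanishes on every periodic equilibrium state at zero field, for EVERY averaging
cell `q'`**: `ē_{q'}(Φ_stag)(ω) = |C_{q'}|⁻¹ Σ_c (−1)^{|c|} Re ω(n_{c↑} − n_{c↓}) = 0` since every `ω(n_{x↑} − n_{x↓})` vanishes
(`IsPerVarEquilibrium.expect_nAt_sub_nAt_eq_zero_ttPrime`). [cite: Ghosh1971] [cite: KleinLandauShucker1981] -/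
theorem InfVolFermionState.IsPerVarEquilibrium.cellMeanEnergy_staggeredSpinInteraction_eq_zero (hβ : 0 ≤ β) {θ : Fin 2 → ℝ}
    (h : ω.IsPerVarEquilibrium β q (hubbardStaggered 2 t U θ) 1) (hθ : θ 1 = 0) (q' : Fin 2 → ℕ) (R : ℝ) :
    InfVolFermionState.cellMeanEnergy q' (staggeredSpinInteraction 2) ω R = 0 := by
  rw [hubbardStaggered_two_eq_gcInteractionTT' t U hθ] at h
  rw [InfVolFermionState.cellMeanEnergy_eq_of_onSite (fun X hX => staggeredSpinInteraction_apply_eq_zero hX),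
    Finset.sum_eq_zero fun c _ => ?_, mul_zero]
  rw [staggeredSpinInteraction_apply_singleton, map_smul, smul_eq_mul,
    h.expect_nAt_sub_nAt_eq_zero_ttPrime t 0 U (-θ 0) hβ (Finset.mem_singleton_self _), mul_zero, Complex.zero_re]

/-- **THE PERIODIC PRESSURE OF THE 2D HUBBARD MODEL IS DIFFERENTIABLE IN THE STAGGERED FIELD AT `h_s = 0`, WITH DERIVATIVE `0`**
(every `β > 0`, every real `t, U, θ₀ = −μ`, every period vector `q`): the conjugate density of the staggered field vanishes on every
periodic equilibrium state at zero field, so the tangent is unique and horizontal — no spontaneous staggered magnetisation in the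
Griffiths sense `m_s^± = ∓β⁻¹ ∂^±_{h_s} P = 0`. [cite: Ghosh1971] [cite: Israel1979, Thm. I.2.4] [cite: Griffiths1964, Eq. (39) and Fig. 3] -/
theorem hubbardStaggered_two_hasDerivAt_perVarPressure_zero_field (hβ : 0 < β) (θ₀ : ℝ) (q : Fin 2 → ℕ) :
    HasDerivAt (fun h : ℝ => (hubbardStaggered 2 t U ![θ₀, h]).perVarPressure β q 1) 0 0 := by
  have key := FermionInteraction.hasDerivAt_perVarPressure_linearFamily_of_eq_const (hubbardFermionInteraction 2 t U)
    ![numberInteraction 2, staggeredSpinInteraction 2] q 1 two_pos hβ ![θ₀, 0] 1 (m₀ := 0) (fun ω hω => by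
      have hω' : ω.IsPerVarEquilibrium β q (hubbardStaggered 2 t U ![θ₀, 0]) 1 := hω
      simp only [Matrix.cons_val_one]
      exact hω'.cellMeanEnergy_staggeredSpinInteraction_eq_zero t U hβ.le (by simp) q 1)
  rw [mul_zero, neg_zero] at key
  -- the staggered-field slice of the family is `h ↦ hubbardStaggered 2 t U (θ₀, h)`
  have hfun : (fun h : ℝ => (hubbardStaggered 2 t U ![θ₀, h]).perVarPressure β q 1) =
      fun s : ℝ => (FermionInteraction.linearFamily (hubbardFermionInteraction 2 t U)
        ![numberInteraction 2, staggeredSpinInteraction 2] ((![θ₀, 0] : Fin 2 → ℝ) + Pi.single 1 s)).perVarPressure β q 1 := by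
    funext h
    rw [hubbardStaggered, vec2_add_single_one]
  rw [hfun]
  exact key

/-- **THE STAGGERED MAGNETISATION OF EQUILIBRIUM STATES IN A VANISHING STAGGERED FIELD TENDS TO ZERO** (Ghosh's form): for every
`β ≥ 0`, real `t, U, θ₀`, period `q`, every sequence of staggered couplings `θ₁^{(j)} → 0` and `q`-periodic equilibrium states `ω_j` of
`hubbardStaggered 2 t U (θ₀, θ₁^{(j)})`: `m_s(ω_j) → 0` (weak-⋆ limit points are equilibrium states at zero field, where `m_s = 0`, and
`m_s` is weak-⋆ continuous). [cite: Ghosh1971] [cite: KomaTasakiPRL1992, p. 3] [cite: Israel1979, Thm. I.2.4] -/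
theorem tendsto_staggeredMagnetisation_of_isPerVarEquilibrium_hubbardStaggered (hβ : 0 ≤ β) (θ₀ : ℝ) {hs : ℕ → ℝ}
    (hh : Tendsto hs atTop (𝓝 0)) {ωs : ℕ → InfVolFermionState 2}
    (hω : ∀ j, (ωs j).IsPerVarEquilibrium β q (hubbardStaggered 2 t U ![θ₀, hs j]) 1) :
    Tendsto (fun j => (ωs j).staggeredMagnetisation) atTop (𝓝 0) := by
  refine tendsto_of_subseq_tendsto fun ns hns => ?_
  obtain ⟨φ, hφ, ωl, hlim⟩ := InfVolFermionState.exists_tendsto_expect_subseq (fun j => ωs (ns j))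
  refine ⟨φ, ?_⟩
  have hθ : ∀ b : Fin 2, Tendsto (fun j => (![θ₀, hs (ns (φ j))] : Fin 2 → ℝ) b) atTop (𝓝 ((![θ₀, 0] : Fin 2 → ℝ) b)) := by
    intro b
    fin_cases b
    · simp only [Fin.zero_eta, Fin.isValue, Matrix.cons_val_zero]
      exact tendsto_const_nhds
    · simp only [Fin.mk_one, Fin.isValue, Matrix.cons_val_one]
      exact hh.comp (hns.comp hφ.tendsto_atTop)
  have hωl : ωl.IsPerVarEquilibrium β q (hubbardStaggered 2 t U ![θ₀, 0]) 1 :=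
    InfVolFermionState.isPerVarEquilibrium_of_tendsto_params two_pos hlim (fun j => hω (ns (φ j))) tendsto_const_nhds hθ
  have h0 : ωl.staggeredMagnetisation = 0 := hωl.staggeredMagnetisation_eq_zero_hubbardStaggered t U hβ (by simp)
  have hcont := InfVolFermionState.tendsto_cellMeanEnergy_of_tendsto_expect hlim (evenPeriods 2) (staggeredSpinInteraction 2) 1
  simp only [InfVolFermionState.cellMeanEnergy_staggeredSpinInteraction] at hcont
  rwa [h0] at hcont

/-- **Corollary: no spontaneous staggered magnetisation from either side.** For `β ≥ 0` and ANY choice of `(2ℤ)²`-periodic equilibrium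
states `ω_h` of `hubbardStaggered 2 t U (θ₀, h)` (they exist: `exists_isPerVarEquilibrium_hubbardStaggered`), `m_s(ω_h) → 0` as `h → 0`.
[cite: Ghosh1971] [cite: KomaTasakiPRL1992, p. 3] -/
theorem tendsto_staggeredMagnetisation_nhds_zero_hubbardStaggered (hβ : 0 ≤ β) (θ₀ : ℝ) {ωf : ℝ → InfVolFermionState 2}
    (hω : ∀ h : ℝ, (ωf h).IsPerVarEquilibrium β q (hubbardStaggered 2 t U ![θ₀, h]) 1) :
    Tendsto (fun h => (ωf h).staggeredMagnetisation) (𝓝 0) (𝓝 0) :=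
  tendsto_of_seq_tendsto fun hs hh =>
    tendsto_staggeredMagnetisation_of_isPerVarEquilibrium_hubbardStaggered t U hβ θ₀ hh fun j => hω (hs j)

end Hubbard


/-! ### §3 Bookkeeping: pencils as one-direction linear families; the base interaction -/

/-- A pencil `Ψ₀ + sΨ₁` is the linear family with one direction at coupling `0 + s·1₀`. [cite: KomaTasaki1994, §1] -/
theorem FermionInteraction.pencil_eq_linearFamily_single (Ψ₀ Ψ₁ : FermionInteraction d) (s : ℝ) :
    FermionInteraction.pencil Ψ₀ Ψ₁ s =
      FermionInteraction.linearFamily Ψ₀ (fun _ : Fin 1 => Ψ₁) ((fun _ => (0 : ℝ)) + Pi.single (0 : Fin 1) s) := by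
  refine FermionInteraction.ext fun X => ?_
  rw [FermionInteraction.pencil_apply, FermionInteraction.linearFamily_apply, Fin.sum_univ_one, Pi.add_apply, Pi.single_eq_same,
    zero_add]

/-- The base of the sourced family is the zero-Zeeman-field grand-canonical `t–t'` interaction:
`hubbardTTPrimeMuInteraction t t' U μ = gcInteractionTT' t t' U μ 0`. [cite: KomaTasaki1994, §1] -/
theorem hubbardTTPrimeMuInteraction_eq_gcInteractionTT' (t t' U μ : ℝ) :
    hubbardTTPrimeMuInteraction t t' U μ = gcInteractionTT' t t' U μ 0 := by
  refine FermionInteraction.ext fun X => ?_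
  rw [hubbardTTPrimeMuInteraction_apply, gcInteractionTT', FermionInteraction.linearFamily_apply, Fin.sum_univ_two]
  simp only [Matrix.cons_val_zero, Matrix.cons_val_one, neg_zero, Complex.ofReal_zero, zero_smul, add_zero]

/-! ### §4 Periodic equilibrium states have zero pair-source density -/

section PairSource

variable (t t' U μ hz : ℝ) {β : ℝ} (hβ : 0 ≤ β) {q : Fin 2 → ℕ} {ω : InfVolFermionState 2}
include hβ

/-- **`ω(c_{x↑}c_{y↓} − c_{x↓}c_{y↑}) = 0`** for every singlet pair of every region, in every periodic equilibrium state of the 2D `t–t'`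
Hubbard model (both products are pair annihilators). [cite: KomaTasakiPRL1992, p. 3] [cite: KleinLandauShucker1981] -/
theorem InfVolFermionState.IsPerVarEquilibrium.expect_singletPairAt_eq_zero_ttPrime
    (h : ω.IsPerVarEquilibrium β q (gcInteractionTT' t t' U μ hz) 1) {X : Finset (Site 2)} {x y : Site 2} (hx : x ∈ X) (hy : y ∈ X) :
    ω.expect X (singletPairAt x y hx hy) = 0 := by
  have h1 := h.expect_annihilation_mul_annihilation_eq_zero_ttPrime t t' U μ hz hβ
    (orb (PolySite.pt x hx) 0) (orb (PolySite.pt y hy) 1)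
  have h2 := h.expect_annihilation_mul_annihilation_eq_zero_ttPrime t t' U μ hz hβ
    (orb (PolySite.pt x hx) 1) (orb (PolySite.pt y hy) 0)
  show ω.expect X (annihilation (orb (PolySite.pt x hx) 0) * annihilation (orb (PolySite.pt y hy) 1) -
    annihilation (orb (PolySite.pt x hx) 1) * annihilation (orb (PolySite.pt y hy) 0)) = 0
  rw [map_sub, h1, h2, sub_zero]

/-- **Every term of the pair source has zero expectation** in every periodic equilibrium state of the 2D `t–t'` Hubbard model.
[cite: KomaTasakiPRL1992, p. 3] [cite: KomaTasaki1994, §1] -/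
theorem InfVolFermionState.IsPerVarEquilibrium.expect_pairSourceInteraction_eq_zero_ttPrime
    (h : ω.IsPerVarEquilibrium β q (gcInteractionTT' t t' U μ hz) 1) (g : Site 2 → ℝ) (X : Finset (Site 2)) :
    ω.expect X ((pairSourceInteraction g).Φ X) = 0 := by
  by_cases h1 : ∃ x : Site 2, X = {x}
  · obtain ⟨x, rfl⟩ := h1
    rw [pairSourceInteraction_apply_singleton, map_smul, map_add, ω.expect_conjTranspose,
      h.expect_singletPairAt_eq_zero_ttPrime t t' U μ hz hβ, star_zero, add_zero, smul_zero]
  · by_cases h2 : ∃ (x : Site 2) (i : Fin 2), X = {x, x + unitVec i}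
    · obtain ⟨x, i, rfl⟩ := h2
      rw [pairSourceInteraction_apply_pair, map_smul, map_add, ω.expect_conjTranspose,
        h.expect_singletPairAt_eq_zero_ttPrime t t' U μ hz hβ, star_zero, add_zero, smul_zero]
    · rw [pairSourceInteraction_apply_eq_zero g (fun x hx => h1 ⟨x, hx⟩) (fun x i hx => h2 ⟨x, i, hx⟩), map_zero]

/-- **The pair-source density of every periodic equilibrium state vanishes, for every averaging cell `q'`**:
`ē_{q'}(P_g)(ω) = 0`. [cite: KomaTasakiPRL1992, p. 3] [cite: KomaTasaki1994, §1] -/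
theorem InfVolFermionState.IsPerVarEquilibrium.cellMeanEnergy_pairSourceInteraction_eq_zero_ttPrime
    (h : ω.IsPerVarEquilibrium β q (gcInteractionTT' t t' U μ hz) 1) (g : Site 2 → ℝ) (q' : Fin 2 → ℕ) (R : ℝ) :
    InfVolFermionState.cellMeanEnergy q' (pairSourceInteraction g) ω R = 0 := by
  unfold InfVolFermionState.cellMeanEnergy
  rw [Finset.sum_eq_zero fun c _ => ?_, mul_zero]
  rw [InfVolFermionState.siteEnergy_apply, Finset.sum_eq_zero fun Y _ => ?_, Complex.zero_re]
  rw [h.expect_pairSourceInteraction_eq_zero_ttPrime t t' U μ hz hβ g Y, mul_zero]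

end PairSource

/-! ### §5 The pressure is differentiable in the pair source at zero source, with derivative `0` -/

/-- The one-direction coupling vector: `0 + s·1₀ = (s)` on `Fin 1`. [cite: KomaTasaki1994, §1] -/
private theorem fin1_zero_add_single (s : ℝ) : ((fun _ => (0 : ℝ)) : Fin 1 → ℝ) + Pi.single (0 : Fin 1) s = fun _ => s := by
  funext a
  rw [Subsingleton.elim a 0, Pi.add_apply, Pi.single_eq_same, zero_add]

section Source

variable (t t' U μ : ℝ) (g : Site 2 → ℝ) {β : ℝ}

/-- **NO KINK OF THE PERIODIC PRESSURE IN THE PAIR SOURCE** (every `β > 0`, every period `q`, every real form factor `g`):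
`h ↦ P_q(β, (Φ^{t,t',U} − μn) − hP_g)` is differentiable at `h = 0` with derivative `0` — the pair-source density vanishes on every
periodic equilibrium state at zero source (§4), so the tangent is unique (`FermionInteraction.hasDerivAt_perVarPressure_linearFamily_of_eq_const`).
[cite: KomaTasakiPRL1992, p. 3] [cite: Griffiths1966, §II] [cite: Israel1979, Thm. I.2.4] -/
theorem hubbardTTPrimeSourced_hasDerivAt_perVarPressure_zero_source (hβ : 0 < β) (q : Fin 2 → ℕ) :
    HasDerivAt (fun h : ℝ => (hubbardTTPrimeSourcedInteraction t t' U μ g h).perVarPressure β q 1) 0 0 := by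
  -- the linear family `s ↦ Ψ₀ + s P_g` has derivative `0` at `s = 0`
  have key := FermionInteraction.hasDerivAt_perVarPressure_linearFamily_of_eq_const (hubbardTTPrimeMuInteraction t t' U μ)
    (fun _ : Fin 1 => pairSourceInteraction g) q 1 two_pos hβ (fun _ => (0 : ℝ)) (0 : Fin 1) (m₀ := 0) (fun ω hω => by
      have h0 : FermionInteraction.linearFamily (hubbardTTPrimeMuInteraction t t' U μ) (fun _ : Fin 1 => pairSourceInteraction g)
          (fun _ => (0 : ℝ)) = gcInteractionTT' t t' U μ 0 := by
        rw [← hubbardTTPrimeMuInteraction_eq_gcInteractionTT']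
        exact FermionInteraction.linearFamily_zero (hubbardTTPrimeMuInteraction t t' U μ) (fun _ : Fin 1 => pairSourceInteraction g)
      rw [h0] at hω
      exact hω.cellMeanEnergy_pairSourceInteraction_eq_zero_ttPrime t t' U μ 0 hβ.le g q 1)
  rw [mul_zero, neg_zero] at key
  -- the sourced interaction at `h` is the family at `s = −h`
  have hfun : (fun h : ℝ => (hubbardTTPrimeSourcedInteraction t t' U μ g h).perVarPressure β q 1) =
      (fun s : ℝ => (FermionInteraction.linearFamily (hubbardTTPrimeMuInteraction t t' U μ) (fun _ : Fin 1 => pairSourceInteraction g)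
        ((fun _ => (0 : ℝ)) + Pi.single (0 : Fin 1) s)).perVarPressure β q 1) ∘ Neg.neg := by
    funext h
    simp only [Function.comp_apply]
    rw [hubbardTTPrimeSourcedInteraction, FermionInteraction.pencil_eq_linearFamily_single]
  rw [hfun]
  have key' : HasDerivAt (fun s : ℝ => (FermionInteraction.linearFamily (hubbardTTPrimeMuInteraction t t' U μ)
      (fun _ : Fin 1 => pairSourceInteraction g) ((fun _ => (0 : ℝ)) + Pi.single (0 : Fin 1) s)).perVarPressure β q 1) 0 (-0) := by
    rw [neg_zero]; exact key
  have hc := key'.comp (0 : ℝ) (hasDerivAt_neg (0 : ℝ))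
  rwa [zero_mul] at hc

/-- **No kink of the translation-invariant variational pressure** `P_var(β, ·)` of `TIVariationalPressure` in the pair source at `0`
(`β > 0`): `P_var = P_q` for translation-covariant interactions. [cite: KomaTasakiPRL1992, p. 3] [cite: Israel1979, Thm. I.2.4] -/
theorem hubbardTTPrimeSourced_hasDerivAt_varPressure_zero_source (hβ : 0 < β) :
    HasDerivAt (fun h : ℝ => (hubbardTTPrimeSourcedInteraction t t' U μ g h).varPressure β 1) 0 0 := by
  have hfun : (fun h : ℝ => (hubbardTTPrimeSourcedInteraction t t' U μ g h).varPressure β 1) =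
      fun h : ℝ => (hubbardTTPrimeSourcedInteraction t t' U μ g h).perVarPressure β 0 1 := by
    funext h
    rw [FermionInteraction.perVarPressure_eq_varPressure two_pos β 0 (hubbardTTPrimeSourcedInteraction_isTranslationInvariant t t' U μ g h) 1]
  rw [hfun]
  exact hubbardTTPrimeSourced_hasDerivAt_perVarPressure_zero_source t t' U μ g hβ 0

/-- **NO KINK OF THE THERMODYNAMIC PRESSURE OF THE 2D `t–t'` HUBBARD MODEL IN THE PAIR SOURCE AT ZERO SOURCE, AT ANY `T > 0`**:
the free-boundary pressure `h ↦ P_free(β, (Φ^{t,t',U} − μn) − hP_g) = lim_n n^{-2} log Tr e^{−βH_{[0,n)²}}` is differentiable at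
`h = 0` with derivative `0` (`β > 0`; `P_free = P_var`, `FermionGibbsVariationalPrinciple`): the spontaneous (quasi-average) pair
amplitude `∓β⁻¹ ∂^±_h P_free(0)` is zero — no superconducting condensation of any singlet nearest-neighbour symmetry (`s`, extended `s`,
`d_{x²−y²}`, …) at positive temperature in two dimensions. [cite: KomaTasakiPRL1992, p. 3] [cite: Griffiths1966, §II] -/
theorem hubbardTTPrimeSourced_hasDerivAt_freePressure_zero_source (hβ : 0 < β) :
    HasDerivAt (fun h : ℝ => (hubbardTTPrimeSourcedInteraction t t' U μ g h).freePressure β) 0 0 := by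
  have hfun : (fun h : ℝ => (hubbardTTPrimeSourcedInteraction t t' U μ g h).freePressure β) =
      fun h : ℝ => (hubbardTTPrimeSourcedInteraction t t' U μ g h).varPressure β 1 := by
    funext h
    rw [FermionInteraction.varPressure_eq_freePressure two_pos (hubbardTTPrimeSourcedInteraction_isHermitian t t' U μ g h)
      (hubbardTTPrimeSourcedInteraction_isEven t t' U μ g h) (hubbardTTPrimeSourcedInteraction_isTranslationInvariant t t' U μ g h)
      (hubbardTTPrimeSourcedInteraction_hasFiniteRange t t' U μ g h) hβ.le]
  rw [hfun]
  exact hubbardTTPrimeSourced_hasDerivAt_varPressure_zero_source t t' U μ g hβ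

/-! ### §6 Pair amplitudes of equilibrium states in a vanishing source tend to zero -/

/-- **THE PAIR-SOURCE DENSITY OF EQUILIBRIUM STATES IN A VANISHING PAIR SOURCE TENDS TO ZERO** (`β ≥ 0`, every period `q`): for sources
`h_j → 0` and `q`-periodic equilibrium states `ω_j` of `(Φ^{t,t',U} − μn) − h_jP_g`, `ē_q(P_g)(ω_j) → 0`.
[cite: KomaTasakiPRL1992, p. 3] [cite: Israel1979, Thm. I.2.4] -/
theorem tendsto_cellMeanEnergy_pairSource_of_isPerVarEquilibrium_sourced (hβ : 0 ≤ β) {q : Fin 2 → ℕ} {hs : ℕ → ℝ}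
    (hh : Tendsto hs atTop (𝓝 0)) {ωs : ℕ → InfVolFermionState 2}
    (hω : ∀ j, (ωs j).IsPerVarEquilibrium β q (hubbardTTPrimeSourcedInteraction t t' U μ g (hs j)) 1) :
    Tendsto (fun j => InfVolFermionState.cellMeanEnergy q (pairSourceInteraction g) (ωs j) 1) atTop (𝓝 0) := by
  have hω' : ∀ j, (ωs j).IsPerVarEquilibrium β q (FermionInteraction.linearFamily (hubbardTTPrimeMuInteraction t t' U μ)
      (fun _ : Fin 1 => pairSourceInteraction g) (fun _ => -hs j)) 1 := by
    intro j
    have e : hubbardTTPrimeSourcedInteraction t t' U μ g (hs j) = FermionInteraction.linearFamily (hubbardTTPrimeMuInteraction t t' U μ)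
        (fun _ : Fin 1 => pairSourceInteraction g) (fun _ => -hs j) := by
      rw [hubbardTTPrimeSourcedInteraction, FermionInteraction.pencil_eq_linearFamily_single, fin1_zero_add_single]
    rw [← e]
    exact hω j
  have hθ : ∀ b : Fin 1, Tendsto (fun j => (fun _ : Fin 1 => -hs j) b) atTop (𝓝 ((fun _ : Fin 1 => (0 : ℝ)) b)) := by
    intro b
    have h := hh.neg
    rwa [neg_zero] at h
  refine FermionInteraction.tendsto_cellMeanEnergy_of_isPerVarEquilibrium_linearFamily (hubbardTTPrimeMuInteraction t t' U μ)
    (fun _ : Fin 1 => pairSourceInteraction g) q 1 two_pos (0 : Fin 1) (fun ω hω => ?_) hθ hω'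
  have h0 : FermionInteraction.linearFamily (hubbardTTPrimeMuInteraction t t' U μ) (fun _ : Fin 1 => pairSourceInteraction g)
      (fun _ => (0 : ℝ)) = gcInteractionTT' t t' U μ 0 := by
    rw [← hubbardTTPrimeMuInteraction_eq_gcInteractionTT']
    exact FermionInteraction.linearFamily_zero (hubbardTTPrimeMuInteraction t t' U μ) (fun _ : Fin 1 => pairSourceInteraction g)
  rw [h0] at hω
  exact hω.cellMeanEnergy_pairSourceInteraction_eq_zero_ttPrime t t' U μ 0 hβ g q 1

end Source

end Literature.MathematicalPhysics.QuantumLattice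

end
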